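import Summits.QuantumFields.YangMills.Theorems.BalabanLadderROTUVExtract
import Summits.QuantumFields.YangMills.Theorems.LangevinControlUVOSLegsFromFemtoAndGapStubAssemblyInheritance
import Summits.QuantumFields.YangMills.Theorems.LangevinControlUVOSLegsFromFemtoAndGapStubAssemblyLowDegree
import HarnessLib

/-!
# Route `F4SubCurvatureDoor`, crux `SubCurvatureKernel` ⟨stmt-QuantumFields-23036⟩ — the TRANSLATION RUNG:
# off-diagonal limit points of the legs are translation invariant on `⁰𝒮` (under `MomentBounds6`)

Helper file (`--supports stmt-QuantumFields-23036 --as helper`; owner ym-idea-3 g23's «(T) GO», HOME INBOX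
2026-08-29T16:34:43Z; free-hands seat `ym-line-frs-p2` g17).  Definition-free, 0 sorry, standard axioms.  No item is closed;
no summit, no crux and no mass gap is proved by this file.

WHY.  The crux `SubCurvatureKernel` (route file `Theses/F4SubCurvatureDoor.lean` :338ff) asks, for every off-diagonal limit point
`S₁` of the `a⁻⁴`-renormalised `tr F²` distributions along an admissible leg scheme (`OffDiagLimitAlong r sch φ S₁` under
`MomentBounds6 G r a`, `IsLegScheme a sch`), for a two-point KERNEL `K(x₀ − x₁)` representing `S₁ 2` (continuous off `0`, bounded
off the unit ball, `W(B₄)`-invariant, reflection positive, sub-curvature, faithful on King germs).  A kernel of the difference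
variable presupposes TRANSLATION INVARIANCE of `S₁ 2`; the tree had this inheritance only for soft bundles / for limits converging at
EVERY arity with `S₁ 0 = δ` (✓`limit_isNormalized_isSymmetric_translate`, toolkit VIII-b), while a bare leg-scheme limit point
leaves `S₁ 0` free and converges only for `n ≥ 2`.  This file re-runs the E1 clause at fixed arity:

* §1 `translate_defect_tendsto_zero` — along ANY admissible scheme (no moment bounds needed), for every arity `n`, every `t ∈ ℝ⁴`
  and every test function `F`, the lattice translates `a_k⌊t/a_k⌋` act on the centred density distributions with an `O(a_k)`
  defect (toolkit VIII-a ✓`norm_latticeDistStr_translate_sub_le`: wrap zone only, weights `≤ (C₀ + C₀)ⁿ`), which tends to `0`;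
* §2 `latticeDist_norm_le_eventually` — the `a`-uniform `⁰𝒮` bound of toolkit VI-c (✓`latticeDist_norm_le_of_momentBounds`, fed by
  ✓`momentBounds_of_momentBounds6`) holds EVENTUALLY along every subsequence of an admissible scheme (tail into `β ≥ β₄`, `a ≤ ℓ₄`);
* §3 ★ `translate_invariant_of_offDiagLimitAlong` — every off-diagonal limit point along a leg scheme is invariant on `⁰𝒮ₙ` under
  ALL translations of `ℝ⁴`, for EVERY arity `n` (arity `0`: the translate of a `0`-point test function is itself; arity `1`:
  `S₁ 1 = 0`; `n ≥ 2`: ✓`translateMulti_apply_eq_of_tendsto` with §1, §2 and `a_k⌊t/a_k⌋ → t`); and the same in the crux's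
  quantifier prefix, `subCurvatureKernel_rung_translate`.

References: K. Osterwalder, R. Schrader, CMP 31 (1973) §2 (E1); J. Glimm, A. Jaffe, Quantum Physics (1987) §6.1 (lattice
approximation and Euclidean invariance of the limit).

HONEST LABEL: one structural rung (E1-translations) toward the SOFT half of ⟨23036⟩; the kernel extraction, its continuity off `0`,
reflection positivity of bare leg-scheme limits, King faithfulness and — above all — the SUB-CURVATURE clause (asymptotic freedom of
the continuum `tr F²` two-point function) remain OPEN; ⟨23036⟩ is an open problem; the Yang–Mills mass gap is NOT proved; no summit
is proved by a line.
-/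

set_option autoImplicit false

noncomputable section

open scoped SchwartzMap BigOperators
open MeasureTheory Filter Topology
open Literature.MathematicalPhysics.QuantumFieldTheory Literature.MathematicalPhysics.QuantumLattice
open Literature.MathematicalPhysics.AQFT
open Literature.Probability.LatticeModels (Site)
open Summit.QuantumFields.YangMills.Cruxes.OSLegsFromFemtoAndGap.DlrCollarTransfer (MomentBounds MomentBounds6)
open Summit.QuantumFields.YangMills.Theorems.OSLegsFromFemtoAndGap
open Summit.QuantumFields.YangMills.Theorems.ROT (IsLegScheme OffDiagLimitAlong)
open Summit.QuantumFields.YangMills.Theorems.NPointIsotropy.Negative (E4)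

namespace Summit.QuantumFields.YangMills.Theorems.F4SubCurvatureDoorSubCurvatureKernelTranslation

variable {G : Type} [Group G] [TopologicalSpace G] [IsTopologicalGroup G] [CompactSpace G]
  [MeasurableSpace G] [BorelSpace G]

/-! ## §1 The `O(a_k)` translation defect dies along any admissible scheme -/

omit [TopologicalSpace G] [IsTopologicalGroup G] [CompactSpace G] [BorelSpace G] in
/-- Along an admissible scheme the lattice vector `v_k = ⌊t/a_k⌋` eventually fits in the torus with room to spare:
`2‖v_k‖ ≤ L_k` (since `2‖t‖/a_k + 2 ≤ a_k⁻² ≤ L_k` once `2‖t‖a_k + 2a_k² ≤ 1`). -/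
theorem eventually_two_norm_floor_le {a : ℝ → ℝ} {sch : SpeciesScheme (YMSpecies G)} (hsch : IsLegScheme a sch)
    {φ : ℕ → ℕ} (hφ : Tendsto φ atTop atTop) (t : E4) :
    ∀ᶠ j in atTop, 2 * ‖(fun k : Fin 4 => ⌊t k / sch.a (φ j)⌋ : Site 4)‖ ≤ (sch.L (φ j) : ℝ) := by
  obtain ⟨-, -, hranges⟩ := hsch
  have haφ : Tendsto (fun j => sch.a (φ j)) atTop (𝓝 0) := sch.tendsto_a.comp hφ
  have h1 : Tendsto (fun j => 2 * ‖t‖ * sch.a (φ j) + 2 * (sch.a (φ j) * sch.a (φ j))) atTop (𝓝 0) := by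
    simpa using ((haφ.const_mul (2 * ‖t‖)).add ((haφ.mul haφ).const_mul 2))
  have h2 : ∀ᶠ j in atTop, 2 * ‖t‖ * sch.a (φ j) + 2 * (sch.a (φ j) * sch.a (φ j)) ≤ 1 :=
    (h1.eventually (ge_mem_nhds one_pos)).mono fun j hj => hj
  refine h2.mono fun j hj => ?_
  have haj : 0 < sch.a (φ j) := sch.a_pos _
  have hvj := norm_floor_le t haj
  have hLj : (sch.a (φ j))⁻¹ * (sch.a (φ j))⁻¹ ≤ sch.L (φ j) := (hranges (φ j)).2.2.2
  have h3 : 2 * (‖t‖ / sch.a (φ j) + 1) ≤ (sch.a (φ j))⁻¹ * (sch.a (φ j))⁻¹ := by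
    rw [div_eq_mul_inv]
    have key : (2 * ‖t‖ * sch.a (φ j) + 2 * (sch.a (φ j) * sch.a (φ j))) * ((sch.a (φ j))⁻¹ * (sch.a (φ j))⁻¹) ≤
        1 * ((sch.a (φ j))⁻¹ * (sch.a (φ j))⁻¹) :=
      mul_le_mul_of_nonneg_right hj (by positivity)
    have hexp : (2 * ‖t‖ * sch.a (φ j) + 2 * (sch.a (φ j) * sch.a (φ j))) * ((sch.a (φ j))⁻¹ * (sch.a (φ j))⁻¹) =
        2 * (‖t‖ * (sch.a (φ j))⁻¹ + 1) := by field_simp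
    linarith [hexp ▸ key]
  calc 2 * ‖(fun k : Fin 4 => ⌊t k / sch.a (φ j)⌋ : Site 4)‖ ≤ 2 * (‖t‖ / sch.a (φ j) + 1) := by linarith [hvj]
    _ ≤ (sch.a (φ j))⁻¹ * (sch.a (φ j))⁻¹ := h3
    _ ≤ sch.L (φ j) := hLj

/-- **§1 The translation defect of the centred density distributions tends to zero along any admissible scheme.**  For every
arity `n`, every `t ∈ ℝ⁴` and every test function `F`, with `b_k = a_k⌊t/a_k⌋` the lattice approximant of `t` at spacing
`a_k = sch.a (φ k)`: `latticeDist_k (F(· − b_k)) − latticeDist_k F → 0`.  No moment bounds are needed: the weights of the bounded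
action density are `≤ (C₀ + C₀)ⁿ` and toolkit VIII-a bounds the wrap-zone defect by `O(a_k)`. [cite: GlimmJaffe1987, §6.1] -/
theorem translate_defect_tendsto_zero (r : LatticeRep G) {a : ℝ → ℝ} {sch : SpeciesScheme (YMSpecies G)}
    (hsch : IsLegScheme a sch) {φ : ℕ → ℕ} (hφ : Tendsto φ atTop atTop) (n : ℕ) (t : E4)
    (F : 𝓢((Fin n → E4), ℂ)) :
    Tendsto (fun j => latticeDist r.ρ (sch.β (φ j)) (sch.L (φ j)) (sch.a (φ j)) r.curvature.F
        (wilsonTorusMean r.ρ (sch.β (φ j)) (sch.L (φ j)) r.curvature.F) n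
        (translateMulti (sch.a (φ j) • siteToE (fun k : Fin 4 => ⌊t k / sch.a (φ j)⌋)) F) -
      latticeDist r.ρ (sch.β (φ j)) (sch.L (φ j)) (sch.a (φ j)) r.curvature.F
        (wilsonTorusMean r.ρ (sch.β (φ j)) (sch.L (φ j)) r.curvature.F) n F) atTop (𝓝 0) := by
  have hranges := hsch.2.2
  have haφ : Tendsto (fun j => sch.a (φ j)) atTop (𝓝 0) := sch.tendsto_a.comp hφ
  -- the weights are bounded by `(C₀ + C₀)ⁿ`
  obtain ⟨C₀, hC₀⟩ := r.curvature.bounded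
  have hC₀0 : 0 ≤ C₀ := le_trans (abs_nonneg _) (hC₀ (fun _ => 1))
  have hW : ∀ (j : ℕ) (x : Fin n → Site 4), |torusMoment r.ρ (sch.β (φ j)) (sch.L (φ j)) r.curvature.F
      (wilsonTorusMean r.ρ (sch.β (φ j)) (sch.L (φ j)) r.curvature.F) x| ≤ (C₀ + C₀) ^ n := by
    intro j x
    refine (abs_torusMoment_le_pow r _ _ r.curvature hC₀ _ x).trans ?_
    exact pow_le_pow_left₀ (by positivity)
      (by linarith [abs_wilsonTorusMean_le r (sch.β (φ j)) (sch.L (φ j)) r.curvature hC₀]) n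
  -- the `O(a)` bound, eventually (once `2‖v_k‖ ≤ L_k`)
  have hbound : ∀ᶠ j in atTop,
      ‖latticeDist r.ρ (sch.β (φ j)) (sch.L (φ j)) (sch.a (φ j)) r.curvature.F
          (wilsonTorusMean r.ρ (sch.β (φ j)) (sch.L (φ j)) r.curvature.F) n
          (translateMulti (sch.a (φ j) • siteToE (fun k : Fin 4 => ⌊t k / sch.a (φ j)⌋)) F) -
        latticeDist r.ρ (sch.β (φ j)) (sch.L (φ j)) (sch.a (φ j)) r.curvature.F
          (wilsonTorusMean r.ρ (sch.β (φ j)) (sch.L (φ j)) r.curvature.F) n F‖ ≤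
        2 * 3 ^ (4 * n) * 2 ^ (8 * n + 1) * (C₀ + C₀) ^ n * SchwartzMap.seminorm ℂ (8 * n + 1) 0 F * sch.a (φ j) :=
    (eventually_two_norm_floor_le hsch hφ t).mono fun j hj => by
      have ha1 : sch.a (φ j) ≤ 1 := by linarith [(hranges (φ j)).2.1]
      rw [latticeDist_eq_latticeDistStr]
      exact norm_latticeDistStr_translate_sub_le r.ρ (sch.β (φ j)) (sch.L (φ j)) (fun _ => r.curvature.F)
        (fun _ => wilsonTorusMean r.ρ (sch.β (φ j)) (sch.L (φ j)) r.curvature.F) (by positivity)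
        (fun x => hW j x) (sch.a_pos _) ha1 (hranges (φ j)).2.2.2 _ hj F
  refine squeeze_zero_norm' hbound ?_
  simpa using haφ.const_mul (2 * 3 ^ (4 * n) * 2 ^ (8 * n + 1) * (C₀ + C₀) ^ n * SchwartzMap.seminorm ℂ (8 * n + 1) 0 F)

/-! ## §2 The `a`-uniform `⁰𝒮` bound, eventually along the scheme -/

/-- **§2 `MomentBounds6 ⇒` the E0′-type bound `‖latticeDist_k n F‖ ≤ 5Kⁿ·|F|_{10n}` for `F ∈ ⁰𝒮ₙ`, `n ≥ 2`, EVENTUALLY along every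
subsequence of an admissible leg scheme** (toolkit VI-c ✓`latticeDist_norm_le_of_momentBounds` in the regime `β ≥ β₄`, `a ≤ ℓ₄`,
reached because `β_k → ∞` and `a → 0`; `a_k ≤ 1/24 ≤ 1` and the torus ranges come with the scheme). [cite: GlimmJaffe1987, §6.1] -/
theorem latticeDist_norm_le_eventually (r : LatticeRep G) {a : ℝ → ℝ} (hapos : ∀ β, 0 < a β)
    (ha0 : Tendsto a atTop (𝓝 0)) (hMB : MomentBounds6 G r a) {sch : SpeciesScheme (YMSpecies G)}
    (hsch : IsLegScheme a sch) {φ : ℕ → ℕ} (hφ : Tendsto φ atTop atTop) :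
    ∃ K : ℝ, 0 ≤ K ∧ ∀ n : ℕ, 2 ≤ n → ∀ᶠ j in atTop, ∀ F : 𝓢((Fin n → E4), ℂ), IsOffDiagonal F →
      ‖latticeDist r.ρ (sch.β (φ j)) (sch.L (φ j)) (sch.a (φ j)) r.curvature.F
          (wilsonTorusMean r.ρ (sch.β (φ j)) (sch.L (φ j)) r.curvature.F) n F‖ ≤
        5 * K ^ n * schwartzNorm (10 * n) F := by
  obtain ⟨hunits, hβ, hranges⟩ := hsch
  obtain ⟨β₄, ℓ₄, K, hℓ, hK, H⟩ := latticeDist_norm_le_of_momentBounds r (momentBounds_of_momentBounds6 r a hMB)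
  refine ⟨K, hK, fun n hn => ?_⟩
  have hβφ : Tendsto (fun j => sch.β (φ j)) atTop atTop := hβ.comp hφ
  have haφ : Tendsto (fun j => a (sch.β (φ j))) atTop (𝓝 0) := ha0.comp hβφ
  filter_upwards [hβφ.eventually_ge_atTop β₄, haφ.eventually (eventually_le_nhds hℓ)] with j hjβ hjℓ
  intro F hF
  have ha1 : a (sch.β (φ j)) ≤ 1 := by
    have h := (hranges (φ j)).2.1
    rw [hunits] at h
    linarith
  have hLa : (a (sch.β (φ j)))⁻¹ * (a (sch.β (φ j)))⁻¹ ≤ sch.L (φ j) := by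
    have h := (hranges (φ j)).2.2.2
    rwa [hunits] at h
  rw [hunits]
  calc _ ≤ K ^ n * (SchwartzMap.seminorm ℂ 0 (4 * n) F + SchwartzMap.seminorm ℂ (6 * n) (4 * n) F +
        SchwartzMap.seminorm ℂ 0 0 F + SchwartzMap.seminorm ℂ (6 * n) 0 F + SchwartzMap.seminorm ℂ (10 * n) 0 F) :=
        H _ hjβ (hapos _) ha1 hjℓ _ (hranges (φ j)).2.2.1 hLa n hn F hF
    _ ≤ K ^ n * (5 * schwartzNorm (10 * n) F) := by
        gcongr
        exact seminorm_budget_le_schwartzNorm n F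
    _ = 5 * K ^ n * schwartzNorm (10 * n) F := by ring

/-! ## §3 ★ Translation invariance of off-diagonal limit points of the legs -/

/-- ★ **THE TRANSLATION RUNG.**  Under `MomentBounds6 G r a` (positive unit map `a → 0`), along every admissible leg scheme and every
subsequence `φ → ∞`, every off-diagonal limit point `S₁` (`OffDiagLimitAlong r sch φ S₁`) is invariant on `⁰𝒮` under every
translation of `ℝ⁴`, at EVERY arity: `S₁ n (F(· − t, …, · − t)) = S₁ n F` for `F ∈ ⁰𝒮ₙ`.  Arity `0`: the translate of a `0`-point
test function is itself; arity `1`: `S₁ 1 = 0`; `n ≥ 2`: the lattice approximants `a_k⌊t/a_k⌋ → t` act with defect `→ 0` (§1),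
the distributions are equicontinuous on `⁰𝒮ₙ` (§2), so the limit is invariant (✓`translateMulti_apply_eq_of_tendsto`).
[cite: OS1973, §2 (E1)] [cite: GlimmJaffe1987, §6.1] -/
theorem translate_invariant_of_offDiagLimitAlong (r : LatticeRep G) {a : ℝ → ℝ} (hapos : ∀ β, 0 < a β)
    (ha0 : Tendsto a atTop (𝓝 0)) (hMB : MomentBounds6 G r a) {sch : SpeciesScheme (YMSpecies G)}
    (hsch : IsLegScheme a sch) {φ : ℕ → ℕ} (hφ : Tendsto φ atTop atTop) {S₁ : SchwingerFamily E4}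
    (hS₁ : OffDiagLimitAlong r sch φ S₁) (n : ℕ) (t : E4) (F : 𝓢((Fin n → E4), ℂ)) (hF : IsOffDiagonal F) :
    S₁ n (translateMulti t F) = S₁ n F := by
  obtain ⟨h1, -, hconv⟩ := hS₁
  rcases Nat.lt_or_ge n 2 with hlt | hn
  · interval_cases n
    · rw [show translateMulti t F = F from (by ext x; rw [translateMulti_apply]; congr 1; exact Subsingleton.elim _ _)]
    · rw [h1, h1]
  · obtain ⟨K, -, hK⟩ := latticeDist_norm_le_eventually r hapos ha0 hMB hsch hφ
    have hba : Tendsto (fun j => sch.a (φ j) • siteToE (fun k : Fin 4 => ⌊t k / sch.a (φ j)⌋)) atTop (𝓝 t) := by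
      rw [tendsto_iff_norm_sub_tendsto_zero]
      refine squeeze_zero (fun j => norm_nonneg _) (fun j => norm_smul_siteToE_floor_sub_le t (sch.a_pos _)) ?_
      simpa using (sch.tendsto_a.comp hφ).const_mul 2
    exact translateMulti_apply_eq_of_tendsto
      (S := fun j m => latticeDist r.ρ (sch.β (φ j)) (sch.L (φ j)) (sch.a (φ j)) r.curvature.F
        (wilsonTorusMean r.ρ (sch.β (φ j)) (sch.L (φ j)) r.curvature.F) m) (T := S₁)
      (fun F' hF' => hconv n hn F' hF') (hK n hn) hba
      (fun F' _ => translate_defect_tendsto_zero r hsch hφ n t F') F hF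

/-- **The rung in the crux's quantifier prefix** (`SubCurvatureKernel`'s letters, `Theses/F4SubCurvatureDoor.lean` :338ff): for every
compact simple `G`, representation `r`, positive unit map `a → 0` with `MomentBounds6`, admissible leg scheme, subsequence `φ → ∞` and
off-diagonal limit point `S₁`, every `S₁ n` is translation invariant on `⁰𝒮ₙ`. [cite: OS1973, §2 (E1)] [cite: GlimmJaffe1987, §6.1] -/
theorem subCurvatureKernel_rung_translate :
    ∀ (G : Type) [Group G] [TopologicalSpace G] [IsTopologicalGroup G] [CompactSpace G], IsCompactSimpleLieGroup G →
      letI : MeasurableSpace G := borel G; haveI : BorelSpace G := ⟨rfl⟩;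
      ∀ (r : LatticeRep G) (a : ℝ → ℝ), (∀ β, 0 < a β) → Tendsto a atTop (nhds 0) → MomentBounds6 G r a →
        ∀ sch : SpeciesScheme (YMSpecies G), IsLegScheme a sch → ∀ φ : ℕ → ℕ, Tendsto φ atTop atTop →
          ∀ S₁ : SchwingerFamily E4, OffDiagLimitAlong r sch φ S₁ → ∀ (n : ℕ) (t : E4) (F : 𝓢((Fin n → E4), ℂ)),
            IsOffDiagonal F → S₁ n (translateMulti t F) = S₁ n F := by
  intro G _ _ _ _ _
  letI : MeasurableSpace G := borel G
  haveI : BorelSpace G := ⟨rfl⟩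
  intro r a hapos ha0 hMB sch hsch φ hφ S₁ hS₁ n t F hF
  exact translate_invariant_of_offDiagLimitAlong r hapos ha0 hMB hsch hφ hS₁ n t F hF

end Summit.QuantumFields.YangMills.Theorems.F4SubCurvatureDoorSubCurvatureKernelTranslation

end
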